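/-
Copyright (c) 2026. All rights reserved.
Released under Apache 2.0 license as described in the file LICENSE.
Authors: abc-iut cell, statement-typer seat abc-iut-L4-t3 (wave 1).
-/
import Mathlib.CategoryTheory.Types.Basic
import Literature.AnabelianGeometry.AbsoluteAnabelian.DiagramMorphisms
import Literature.AnabelianGeometry.AbsoluteAnabelian.LogFrobeniusMonoCoresProofs
import HarnessLib

/-!
# [AbsTopIII] Corollary 5.10, preamble: the mono-analyticization morphism `D•_{≥3} → D⊢` and its homotopies; Corollary 5.10 (iv)(a) over them

S. Mochizuki, *Topics in absolute anabelian geometry III: global reconstruction algorithms*,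
J. Math. Sci. Univ. Tokyo 22 (2015) 939–1156 [MochizukiAbsTopIII2015]; locators `p.N` = pages of the
author's manuscript (`paper:url-5493eb38cbb7`), read on the page: Cor 5.10 preamble p. 146 ("we have a natural
mono-analyticization morphism [consisting of arrows between corresponding vertices belonging to rows indexed by
the same integer!] of diagrams of categories `D•_{≥3} → D⊢` … where … we take the arrow `An•[𝒳] → An⊢[𝒩⊢⊞]` to be
the arrow induced, via the equivalence of categories `κ_{An•}` of Corollary 5.5 and the equivalence of categories of
Proposition 5.8, (vii), by the mono-analyticization functor `ℰ• → ℰ⊢`; write `D•⊢` for the diagram of categories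
obtained by gluing `D•`, `D⊢` via this mono-analyticization morphism. We shall refer to the various isomorphisms
between composites of functors inherent in the definition of the mono-analyticization morphism `D•_{≥3} → D⊢`
[e.g., the natural isomorphisms between the functors associated to the two length 2 paths `𝒩⊞_v → 𝒩⊢⊞_v → 𝒩⊢_v`,
`𝒩⊞_v → 𝒩_v → 𝒩⊢_v`, where `v ∈ V(F_mod)`, in the third and fourth rows of `D•⊢`] as mono-analyticization
homotopies"), Def 5.6 (iii), (iv) pp. 135–136 (the "[1-]commutative diagram[s] of natural functors" whose "vertical
arrows are mono-analyticization functors" and whose right-hand arrows "are the natural projection functors"),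
Def 3.5 (v) p. 76 (1-morphisms of diagrams of categories), Cor 5.10 (iv)(a) p. 147.

WHY THIS FILE.  The interface `LogFrobeniusSetting` (`LogFrobeniusCompatibility.lean`, this seat, FROZEN) realises
`D•⊢` directly as ONE quiver `DVertex`/`DEdge` and records, of the mono-analyticization morphism `D•_{≥3} → D⊢` — a
1-morphism of diagrams of categories in the sense of Def 3.5 (v): one functor per vertex, one isomorphism of
functors per edge — the vertex functors (`monoNplus`, `monoN`, `monoAn`, the induced arrow
`κ_{An•}⁻¹ ⋙ (ℰ• → ℰ⊢) ⋙ (ℰ⊢ ⥲ An⊢[𝒩⊢⊞])`, `monoAn`) and the edge isomorphism of rows 3 → 4 (`monoHomotopy`, the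
text's "e.g."), but NOT the edge isomorphisms of rows 4 → 5 (`𝒩_v → ℰ• → ℰ⊢` versus `𝒩_v → 𝒩⊢_v → ℰ⊢`: the right-hand
square of the 1-commutative diagrams of Def 5.6 (iii), (iv) after base-change to `[Z]`) and rows 6 → 7
(`An•[𝒳] → ℰ• → ℰ⊢` versus `An•[𝒳] → An⊢[𝒩⊢⊞] → ℰ⊢`); the rows 5 → 6 isomorphism needs no datum, being induced by the
DEFINITION of the arrow `An•[𝒳] → An⊢[𝒩⊢⊞]`.  abc-iut-L4-t15 proved Cor 5.10 (iv)(a) (`Cor510MonoCores`, the three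
mono-analytic cores) for every setting with `V(F_mod) ≠ ∅` GIVEN exactly these two homotopies
(`cor510MonoCores_of`, `LogFrobeniusMonoCoresProofs.lean`), the layer recording the residual as an "interface gap for
t3".  This file closes it on the typing side, append-only (the frozen interface is untouched):

* INTERFACE ADD-ON `LogFrobeniusSetting.MonoAnalyticizationHomotopies L`: the two missing mono-analyticization
  homotopies, each field quoting its square;
* the morphism itself, REALISED: the vertex map `DVertex.monoOf` ("corresponding vertices belonging to rows indexed
  by the same integer"), the sub-diagrams `D•_{≥3}` (`DVertex.InUpperRows`) and `D⊢` (`DVertex.InMono`) of the realised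
  `D•⊢`, the morphism of oriented graphs `monoGraph : Γ⃗_{D•_{≥3}} → Γ⃗_{D⊢}` and the Def 3.5 (v) 1-morphism
  `monoAnalyticization M : D•_{≥3} → D⊢` (abc-iut-L4-t2's `DiagramOfCategories.OneMorphism`) whose edge isomorphisms are
  `monoHomotopy`, `M.toE`, the canonical rows 5 → 6 isomorphism, `M.anToE`;
* **Cor 5.10 (iv)(a) over the add-on**: `cor510MonoCores_holds M : L.Cor510MonoCores` for every `L` with
  `V(F_mod) ≠ ∅` (one line over `cor510MonoCores_of`), and `cor510MonoCores_iff_nonempty`;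
* non-vacuity: at a diagonal setting (every row one category `C`, every functor `𝟭 C`) both squares commute
  strictly, so the add-on is inhabited by identity isomorphisms — this is abc-iut-w4-d095's calibration
  `LogFrobeniusSetting.exists_cor510MonoCores` (`LogFrobeniusMonoCoresCalibration.lean`, feeding `cor510MonoCores_of`
  with `Iso.refl`), a DEGENERATE witness with no arithmetic content; not repeated here.

The add-on is an ASSUMPTION-FREE typing of printed DATA (part of what the text calls the mono-analyticization
morphism); results over it are results "for every setting equipped with its mono-analyticization homotopies".
Refereed pre-IUT material; nothing here bears on [IUTchIII] Cor. 3.12; OUR kernel check, no side taken; typed ≠ proved.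
-/

set_option autoImplicit false

universe u

open CategoryTheory Quiver

namespace Literature.AnabelianGeometry.AbsoluteAnabelian

variable {Vmod : Type u} {isArc : Vmod → Bool}

/-! ## The sub-diagrams `D•_{≥3}` and `D⊢` of `D•⊢`; "corresponding vertices" -/

namespace DVertex

/-- `D•_{≥3}`: "the portion [of `D•`] involving the rows numbered 3, 4, 5, 6, 7".
[cite: MochizukiAbsTopIII2015, Cor 5.10 p. 146] -/
def InUpperRows (x : DVertex Vmod isArc) : Prop := x.IsHolomorphic ∧ 3 ≤ x.row

/-- `D⊢`: the mono-analytic rows 3–7 glued to `D•` along the mono-analyticization morphism.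
[cite: MochizukiAbsTopIII2015, Cor 5.10 p. 146] -/
def InMono (x : DVertex Vmod isArc) : Prop := ¬ x.IsHolomorphic

/-- "arrows between corresponding vertices belonging to rows indexed by the same integer": the vertex of `D⊢` under a
vertex of `D•_{≥3}` (`𝒩⊞_v ↦ 𝒩⊢⊞_v`, `𝒩_v ↦ 𝒩⊢_v`, `ℰ• ↦ ℰ⊢`, `An•[𝒳] ↦ An⊢[𝒩⊢⊞]`, row-7 `ℰ• ↦ ℰ⊢`; the other vertices,
on which the morphism is not defined, are fixed). [cite: MochizukiAbsTopIII2015, Cor 5.10 p. 146] -/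
def monoOf : DVertex Vmod isArc → DVertex Vmod isArc
  | nplus v => nmonoPlus v
  | nv v => nmono v
  | e5 => emono5
  | an => anMono
  | e7 => emono7
  | x => x

/-- corresponding vertices lie in rows "indexed by the same integer". [cite: MochizukiAbsTopIII2015, Cor 5.10 p. 146] -/
theorem row_monoOf (x : DVertex Vmod isArc) : x.monoOf.row = x.row := by
  cases x <;> rfl

/-- the vertex corresponding to a vertex of `D•_{≥3}` lies in `D⊢`. [cite: MochizukiAbsTopIII2015, Cor 5.10 p. 146] -/
theorem inMono_monoOf {x : DVertex Vmod isArc} (hx : x.InUpperRows) : x.monoOf.InMono := by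
  obtain ⟨h, hr⟩ := hx
  cases x <;> first | exact id | simp [DVertex.row] at hr

end DVertex

namespace DEdge

/-- the arrow of `D⊢` under an arrow of `D•_{≥3}` (`𝒩⊞_v → 𝒩_v ↦ 𝒩⊢⊞_v → 𝒩⊢_v`, `𝒩_v → ℰ• ↦ 𝒩⊢_v → ℰ⊢`,
`ℰ• → An•[𝒳] ↦ ℰ⊢ → An⊢[𝒩⊢⊞]`, `An•[𝒳] → ℰ• ↦ An⊢[𝒩⊢⊞] → ℰ⊢`); the remaining constructors are not arrows of `D•_{≥3}`.
[cite: MochizukiAbsTopIII2015, Cor 5.10 p. 146] -/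
def monoOf : ∀ {a b : DVertex Vmod isArc}, a.InUpperRows → b.InUpperRows → DEdge isArc a b →
    DEdge isArc a.monoOf b.monoOf
  | _, _, _, _, forget v => forgetMono v
  | _, _, _, _, toE v => toEmono v
  | _, _, _, _, κAn => κAnMono
  | _, _, _, _, anToE => anMonoToE
  | _, _, ha, _, log _ => absurd ha.2 (by simp [DVertex.row])
  | _, _, ha, _, toCore _ => absurd ha.2 (by simp [DVertex.row])
  | _, _, ha, _, lam _ _ _ => absurd ha.2 (by simp [DVertex.row])
  | _, _, _, hb, monoNplus _ => absurd hb.1 id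
  | _, _, _, hb, monoN _ => absurd hb.1 id
  | _, _, _, hb, monoE5 => absurd hb.1 id
  | _, _, _, hb, monoAn => absurd hb.1 id
  | _, _, _, hb, monoE7 => absurd hb.1 id
  | _, _, ha, _, forgetMono _ => absurd ha.1 id
  | _, _, ha, _, toEmono _ => absurd ha.1 id
  | _, _, ha, _, κAnMono => absurd ha.1 id
  | _, _, ha, _, anMonoToE => absurd ha.1 id

end DEdge

/-- the morphism of oriented graphs `Γ⃗_{D•_{≥3}} → Γ⃗_{D⊢}` underlying the mono-analyticization morphism (Def 3.5 (v) (a)).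
[cite: MochizukiAbsTopIII2015, Cor 5.10 p. 146] -/
def monoGraph : DSub (DVertex.InUpperRows (Vmod := Vmod) (isArc := isArc)) ⥤q
    DSub (DVertex.InMono (Vmod := Vmod) (isArc := isArc)) where
  obj a := ⟨a.1.monoOf, DVertex.inMono_monoOf a.2⟩
  map {a b} e := DEdge.monoOf a.2 b.2 e

namespace LogFrobeniusSetting

variable (L : LogFrobeniusSetting Vmod isArc)

/-! ## The add-on: the two missing mono-analyticization homotopies -/

/-- INTERFACE ADD-ON (printed data omitted by the frozen `LogFrobeniusSetting`): the **mono-analyticization homotopies**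
of the morphism `D•_{≥3} → D⊢` along the arrows of rows 4 → 5 and 6 → 7 — "the various isomorphisms between composites
of functors inherent in the definition of the mono-analyticization morphism `D•_{≥3} → D⊢`".  (The rows 3 → 4
isomorphism, the text's "e.g.", is the interface's `monoHomotopy`; the rows 5 → 6 one is induced by the definition of
the arrow `An•[𝒳] → An⊢[𝒩⊢⊞]`, `monoIsoκAn`.) [cite: MochizukiAbsTopIII2015, Cor 5.10 p. 146] -/
structure MonoAnalyticizationHomotopies : Type (u + 1) where
  /-- rows 4 → 5: the square `𝒩_v → 𝒩⊢_v → ℰ⊢ ≅ 𝒩_v → ℰ• → ℰ⊢`, i.e. the right-hand square of the 1-commutative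
  diagram `C_{TS} → TG^{sB}` over `C⊢_{TS} → TG⊢` (resp. `C^{hol}_{TH} → EA` over `C^{hol⊢}_{TB} → TM⊢`) of Def 5.6 (iii)
  (resp. (iv)) after the fibred product with `Th•[Z] → Th⊢[Z]` -/
  toE : ∀ v : Vmod, L.monoN v ⋙ L.toEmono v ≅ L.toE v ⋙ L.monoAn
  /-- rows 6 → 7: the square `An•[𝒳] → An⊢[𝒩⊢⊞] → ℰ⊢ ≅ An•[𝒳] → ℰ• → ℰ⊢`, the left vertical arrow being "induced, via
  `κ_{An•}` and the equivalence of Prop 5.8 (vii), by `ℰ• → ℰ⊢`" -/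
  anToE : (L.κAn.inverse ⋙ L.monoAn ⋙ L.κAnMono.functor) ⋙ L.κAnMono.inverse ≅ L.κAn₂.functor ⋙ L.monoAn

namespace MonoAnalyticizationHomotopies

variable {L} (M : L.MonoAnalyticizationHomotopies)

/-- rows 3 → 4 (the text's example): "the natural isomorphism between the functors associated to the two length 2
paths `𝒩⊞_v → 𝒩⊢⊞_v → 𝒩⊢_v`, `𝒩⊞_v → 𝒩_v → 𝒩⊢_v`" — recorded by the interface itself.
[cite: MochizukiAbsTopIII2015, Cor 5.10 p. 146] -/
def forget (v : Vmod) : L.monoNplus v ⋙ L.forgetMono v ≅ L.forget v ⋙ L.monoN v := L.monoHomotopy v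

/-- rows 6 → 7 in the reduced form used by abc-iut-L4-t15's `cor510MonoCores_of` (cancel the unit of the Prop 5.8
(vii) equivalence): `(An•[𝒳] ⥲ ℰ•) ⋙ (ℰ• → ℰ⊢) ≅ κ_{An•}⁻¹ ⋙ (ℰ• → ℰ⊢)`. [cite: MochizukiAbsTopIII2015, Cor 5.10 p. 146] -/
def anToE' : L.κAn₂.functor ⋙ L.monoAn ≅ L.κAn.inverse ⋙ L.monoAn :=
  M.anToE.symm ≪≫ Functor.associator _ _ _ ≪≫
    Functor.isoWhiskerLeft L.κAn.inverse (Functor.associator _ _ _ ≪≫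
      Functor.isoWhiskerLeft L.monoAn L.κAnMono.unitIso.symm ≪≫ L.monoAn.rightUnitor)

end MonoAnalyticizationHomotopies

/-- rows 5 → 6 (no datum): the square `ℰ• → ℰ⊢ ⥲ An⊢[𝒩⊢⊞] ≅ ℰ• ⥲ An•[𝒳] → An⊢[𝒩⊢⊞]` induced by the DEFINITION of the arrow
`An•[𝒳] → An⊢[𝒩⊢⊞]` as `κ_{An•}⁻¹ ⋙ (ℰ• → ℰ⊢) ⋙ (ℰ⊢ ⥲ An⊢[𝒩⊢⊞])` (cancel the unit of `κ_{An•}`).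
[cite: MochizukiAbsTopIII2015, Cor 5.10 p. 146] -/
def monoIsoκAn : L.monoAn ⋙ L.κAnMono.functor ≅
    L.κAn.functor ⋙ (L.κAn.inverse ⋙ L.monoAn ⋙ L.κAnMono.functor) :=
  ((Functor.leftUnitor _).symm ≪≫ Functor.isoWhiskerRight L.κAn.unitIso (L.monoAn ⋙ L.κAnMono.functor)) ≪≫
    Functor.associator _ _ _

/-! ## The mono-analyticization morphism `D•_{≥3} → D⊢` as a 1-morphism of diagrams of categories (Def 3.5 (v)) -/

/-- the vertex functors of the mono-analyticization morphism ("mono-analyticization functors" of Def 5.4 (iv), (vi),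
Def 5.6 (ii)–(iv), and the induced arrow `An•[𝒳] → An⊢[𝒩⊢⊞]`), as a function on all vertices of `D•⊢` (identity off
`D•_{≥3}`, where the morphism is not defined). [cite: MochizukiAbsTopIII2015, Cor 5.10 p. 146] -/
def monoApp : (x : DVertex Vmod isArc) → (x.category L ⥤ x.monoOf.category L)
  | .nplus v => L.monoNplus v
  | .nv v => L.monoN v
  | .e5 => L.monoAn
  | .an => L.κAn.inverse ⋙ L.monoAn ⋙ L.κAnMono.functor
  | .e7 => L.monoAn
  | .row1 _ => 𝟭 _
  | .core => 𝟭 _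
  | .nmonoPlus _ => 𝟭 _
  | .nmono _ => 𝟭 _
  | .emono5 => 𝟭 _
  | .anMono => 𝟭 _
  | .emono7 => 𝟭 _

variable {L} in
/-- the edge isomorphisms of the mono-analyticization morphism (Def 3.5 (v) (c), `Φ_e : 𝒟'_{Φ e} ∘ Φ_{v₁} ⥲ Φ_{v₂} ∘ 𝒟_e`):
rows 3 → 4 `monoHomotopy`, rows 4 → 5 `M.toE`, rows 5 → 6 `monoIsoκAn`, rows 6 → 7 `M.anToE` — the mono-analyticization
homotopies. [cite: MochizukiAbsTopIII2015, Cor 5.10 p. 146] -/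
def monoIso (M : L.MonoAnalyticizationHomotopies) : ∀ {a b : DVertex Vmod isArc} (ha : a.InUpperRows)
    (hb : b.InUpperRows) (e : DEdge isArc a b),
    L.monoApp a ⋙ DEdge.functor L (DEdge.monoOf ha hb e) ≅ DEdge.functor L e ⋙ L.monoApp b
  | _, _, _, _, .forget v => L.monoHomotopy v
  | _, _, _, _, .toE v => M.toE v
  | _, _, _, _, .κAn => L.monoIsoκAn
  | _, _, _, _, .anToE => M.anToE
  | _, _, ha, _, .log _ => absurd ha.2 (by simp [DVertex.row])
  | _, _, ha, _, .toCore _ => absurd ha.2 (by simp [DVertex.row])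
  | _, _, ha, _, .lam _ _ _ => absurd ha.2 (by simp [DVertex.row])
  | _, _, _, hb, .monoNplus _ => absurd hb.1 id
  | _, _, _, hb, .monoN _ => absurd hb.1 id
  | _, _, _, hb, .monoE5 => absurd hb.1 id
  | _, _, _, hb, .monoAn => absurd hb.1 id
  | _, _, _, hb, .monoE7 => absurd hb.1 id
  | _, _, ha, _, .forgetMono _ => absurd ha.1 id
  | _, _, ha, _, .toEmono _ => absurd ha.1 id
  | _, _, ha, _, .κAnMono => absurd ha.1 id
  | _, _, ha, _, .anMonoToE => absurd ha.1 id

variable {L} in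
/-- **The mono-analyticization morphism `D•_{≥3} → D⊢`** of Cor 5.10 as a 1-morphism of diagrams of categories (Def 3.5
(v)) between the sub-diagrams `D•_{≥3}` and `D⊢` of the realised `D•⊢`, over the morphism of oriented graphs
`monoGraph`: vertex functors `monoApp`, edge isomorphisms the mono-analyticization homotopies `monoIso`.
[cite: MochizukiAbsTopIII2015, Cor 5.10 p. 146] -/
def monoAnalyticization (M : L.MonoAnalyticizationHomotopies) :
    DiagramOfCategories.OneMorphism monoGraph (L.subdiagram DVertex.InUpperRows) (L.subdiagram DVertex.InMono) where
  app a := L.monoApp a.1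
  iso {a b} e := L.monoIso M a.2 b.2 e

/-- the realised `D•⊢` indeed contains the arrows "between corresponding vertices" along which it is glued: each vertex
functor of the mono-analyticization morphism IS the functor of an arrow of `D•⊢`.
[cite: MochizukiAbsTopIII2015, Cor 5.10 p. 146] -/
theorem monoApp_eq_functor :
    (L.monoApp (.e5) = DEdge.functor L .monoE5) ∧ (L.monoApp (.an) = DEdge.functor L .monoAn) ∧
      (L.monoApp (.e7) = DEdge.functor L .monoE7) ∧
      (∀ v : Vmod, L.monoApp (.nplus v) = DEdge.functor L (.monoNplus v) ∧
        L.monoApp (.nv v) = DEdge.functor L (.monoN v)) :=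
  ⟨rfl, rfl, rfl, fun _ => ⟨rfl, rfl⟩⟩

/-! ## Corollary 5.10 (iv)(a) over the add-on -/

variable {L} in
/-- **Cor 5.10 (iv)(a)** (Mono-analytic Cores) — "for `n = 5, 6, 7`, `D•⊢_{≤n}` admits a natural structure of core on
the subdiagram of categories of `D•⊢` determined by the union `D•⊢_{≤n-1} ∪ D•_{≤n}` — i.e., loosely speaking, `ℰ⊢`,
`An⊢[𝒩⊢⊞]` 'form cores' of the functors in `D•⊢`" — HOLDS for every log-Frobenius setting with `V(F_mod) ≠ ∅` equipped
with its mono-analyticization homotopies (abc-iut-L4-t15's `cor510MonoCores_of` fed with `M.toE`, `M.anToE'`).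
[cite: MochizukiAbsTopIII2015, Cor 5.10 (iv)(a) p. 147] -/
theorem cor510MonoCores_holds [Nonempty Vmod] (M : L.MonoAnalyticizationHomotopies) : L.Cor510MonoCores :=
  L.cor510MonoCores_of (fun v => ⟨M.toE v⟩) ⟨M.anToE'⟩

variable {L} in
/-- given the mono-analyticization homotopies, the typed Cor 5.10 (iv)(a) holds EXACTLY when `V(F_mod) ≠ ∅` (the
degenerate corner is abc-iut-L4-t15's `not_cor510MonoCores_of_isEmpty`). [cite: MochizukiAbsTopIII2015, Cor 5.10 (iv)(a) p. 147] -/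
theorem cor510MonoCores_iff_nonempty (M : L.MonoAnalyticizationHomotopies) : L.Cor510MonoCores ↔ Nonempty Vmod := by
  refine ⟨fun h => ?_, fun _ => cor510MonoCores_holds M⟩
  by_contra hV
  rw [not_nonempty_iff] at hV
  exact L.not_cor510MonoCores_of_isEmpty h

end LogFrobeniusSetting

end Literature.AnabelianGeometry.AbsoluteAnabelian
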